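import Mathlib
import Literature.Analysis.FluidPDE.SpaceTimeCalculus
import Literature.Analysis.ODE.FlowWithin
import Literature.Analysis.ODE.GlobalExistence
import HarnessLib

/-!
# Route `TautLoopKelvin`, crux `TautLoopLaw` (stmt-NavierStokesRegularity-15249), line
  `Sketch-ideas-r1k1` (Dini–Saks architecture) — tools stub `stub_tautLoopStepFlowExistsTools`
  (existence of the jointly smooth particle-trajectory map of a bounded smooth field on a slab)

For a velocity field `u : ℝ → ℝ³ → ℝ³` jointly smooth on the closed slab `[a, b] × ℝ³`
(`IsSmoothSpaceTimeOn (Icc a b) u`, i.e. `uncurry u` is `C^∞` on `Icc a b ×ˢ univ`), globally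
bounded (`‖u‖ ≤ B₀`) with globally bounded spatial derivative (`‖D(u s)‖ ≤ B₁`), and an anchor time
`s₁ ∈ [a, b]`, we construct the particle-trajectory map `X : ℝ → ℝ³ → ℝ³` with

* `X` jointly smooth on the slab (`IsSmoothSpaceTimeOn (Icc a b) X`);
* `∂ᵣ X(r, y) = u(r, X(r, y))` as a one-sided derivative within `[a, b]` at every `r ∈ [a, b]`;
* `X(s₁, ·) = id`.

Proof (classical; P. Hartman, *Ordinary Differential Equations* (1964), Ch. II, Thm. 1.1 and
Ch. V, Thm. 3.1 / Cor. 3.1; S. Lang, *Differential and Riemannian Manifolds* (1995), Ch. IV §1,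
Thms. 1.14–1.16 and p. 61 (time-dependent fields as autonomous fields on `ℝ × E`)):

1. `tautLoopFlowE_exists_solution`: through every `(s, y) ∈ [a, b] × E` there is a solution of
   `x' = u(t, x)` on the whole of `[a, b]` — Mathlib's Picard–Lindelöf theorem
   (`IsPicardLindelof.exists_eq_forall_mem_Icc_hasDerivWithinAt₀`) applies *globally*, on the
   closed ball of radius `B₀ (b - a)` around `y`, because `u(t, ·)` is `B₁`-Lipschitz on all of
   `E` (mean value inequality) and bounded by `B₀`.
2. `tautLoopFlowE_contDiffOn_flow`: the two-parameter family `((s, y), t) ↦ (s + t, x_{s,y}(s + t))`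
   is a flow *within* the convex set `[a, b] × E` of the autonomised field `(r, x) ↦ (1, u r x)`,
   which is `C^∞` there, on the convex domain `{((s, y), t) : s, s + t ∈ [a, b]}` (nonempty
   interior, hence unique derivatives); the tree's `IsFlowWithin.contDiffOn`
   (`Literature/Analysis/ODE/FlowWithin.lean`, Lang's Thm. 1.16 within a convex set) gives joint
   smoothness — no uniqueness or group law is needed for this step.
3. `tautLoopFlowE_isSmoothSpaceTimeOn`: `X(r, y) = x_{s₁,y}(r)` is the composition of that flow
   with the affine map `(r, y) ↦ ((s₁, y), r - s₁)`.

The helpers are stated over a complete real normed space `E`; the last theorem specialises to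
`ℝ³ = EuclideanSpace ℝ (Fin 3)` and is the registered tools stub, verbatim.
-/

noncomputable section

open Set Function Filter Metric Topology
open scoped NNReal ContDiff
open Literature.Analysis.FluidPDE

namespace Summit.NavierStokesRegularity.NavierStokesRegularity.Theorems

set_option linter.dupNamespace false

variable {E : Type*} [NormedAddCommGroup E] [NormedSpace ℝ E]

/-! ### Global solutions through every point of the slab -/

/-- **Global Picard–Lindelöf on a slab.** For a field `u` jointly smooth on `[a, b] × E` with
`‖u‖ ≤ B₀` and `‖D(u t)‖ ≤ B₁` there, the equation `x' = u(t, x)` has, through every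
`(s, y) ∈ [a, b] × E`, a solution defined on all of `[a, b]` (one-sided derivatives at the
end-points). Mathlib's `IsPicardLindelof` on the ball of radius `B₀ (b - a)` about `y`, where the
a priori speed bound keeps the solution (Hartman 1964, Ch. II, Thm. 1.1). [folklore] -/
theorem tautLoopFlowE_exists_solution [CompleteSpace E] {u : ℝ → E → E} {a b B₀ B₁ : ℝ}
    (hab : a ≤ b) (hB₀ : 0 ≤ B₀) (hB₁ : 0 ≤ B₁) (hu : IsSmoothSpaceTimeOn (Icc a b) u)
    (h₀ : ∀ s ∈ Icc a b, ∀ x, ‖u s x‖ ≤ B₀) (h₁ : ∀ s ∈ Icc a b, ∀ x, ‖fderiv ℝ (u s) x‖ ≤ B₁)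
    {s : ℝ} (hs : s ∈ Icc a b) (y : E) :
    ∃ α : ℝ → E, α s = y ∧ ∀ t ∈ Icc a b, HasDerivWithinAt α (u t (α t)) (Icc a b) t := by
  lift B₀ to ℝ≥0 using hB₀
  lift B₁ to ℝ≥0 using hB₁
  have hPL : IsPicardLindelof u (⟨s, hs⟩ : Icc a b) y (B₀ * Real.toNNReal (b - a)) 0 B₀ B₁ :=
    { lipschitzOnWith := fun t ht =>
        (lipschitzWith_of_nnnorm_fderiv_le (𝕜 := ℝ)
          ((hu.contDiff_slice ht).differentiable (by simp)) fun x => by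
            rw [← NNReal.coe_le_coe, coe_nnnorm]; exact h₁ t ht x).lipschitzOnWith
      continuousOn := fun x _ t ht => (hu.differentiableWithinAt_time ht x).continuousWithinAt
      norm_le := fun t ht x _ => h₀ t ht x
      mul_max_le := by
        rw [NNReal.coe_zero, sub_zero, NNReal.coe_mul, Real.coe_toNNReal _ (sub_nonneg.2 hab)]
        exact mul_le_mul_of_nonneg_left (max_le (by linarith [hs.1]) (by linarith [hs.2])) B₀.2 }
  exact hPL.exists_eq_forall_mem_Icc_hasDerivWithinAt₀

/-! ### The two-parameter flow domain `{((s, y), t) : s, s + t ∈ [a, b]}` -/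

/-- Times between `s` and `s + t` stay in `[a, b]` when `s` and `s + t` do. [folklore] -/
theorem tautLoopFlowE_add_mem_Icc {a b s t r : ℝ} (hs : s ∈ Icc a b) (hst : s + t ∈ Icc a b)
    (hr : r ∈ uIcc 0 t) : s + r ∈ Icc a b := by
  rw [mem_uIcc] at hr
  obtain ⟨h1, h2⟩ := hs
  obtain ⟨h3, h4⟩ := hst
  rcases hr with ⟨h5, h6⟩ | ⟨h5, h6⟩ <;> constructor <;> linarith

/-- The two-parameter flow domain `{((s, y), t) : s ∈ [a, b], s + t ∈ [a, b]}` (initial time and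
point, elapsed time) is convex (an intersection of two linear preimages of `[a, b]`). [folklore] -/
theorem tautLoopFlowE_convex_dom (a b : ℝ) :
    Convex ℝ {z : (ℝ × E) × ℝ | z.1.1 ∈ Icc a b ∧ z.1.1 + z.2 ∈ Icc a b} := by
  let f₁ : (ℝ × E) × ℝ →ₗ[ℝ] ℝ := (LinearMap.fst ℝ ℝ E).comp (LinearMap.fst ℝ (ℝ × E) ℝ)
  let f₂ : (ℝ × E) × ℝ →ₗ[ℝ] ℝ := f₁ + LinearMap.snd ℝ (ℝ × E) ℝ
  have h : {z : (ℝ × E) × ℝ | z.1.1 ∈ Icc a b ∧ z.1.1 + z.2 ∈ Icc a b} =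
      f₁ ⁻¹' Icc a b ∩ f₂ ⁻¹' Icc a b := by
    ext z; simp [f₁, f₂]
  rw [h]
  exact ((convex_Icc a b).linear_preimage f₁).inter ((convex_Icc a b).linear_preimage f₂)

/-- The two-parameter flow domain has unique derivatives when `a < b` (it is convex with the
interior point `(((a + b) / 2, 0), 0)`). [folklore] -/
theorem tautLoopFlowE_uniqueDiffOn_dom {a b : ℝ} (hab : a < b) :
    UniqueDiffOn ℝ {z : (ℝ × E) × ℝ | z.1.1 ∈ Icc a b ∧ z.1.1 + z.2 ∈ Icc a b} := by
  refine uniqueDiffOn_convex (tautLoopFlowE_convex_dom a b) ⟨(((a + b) / 2, 0), 0), ?_⟩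
  rw [mem_interior_iff_mem_nhds, Metric.mem_nhds_iff]
  refine ⟨(b - a) / 4, by linarith, fun z hz => ?_⟩
  rw [mem_ball, dist_eq_norm] at hz
  have h1 : |z.1.1 - (a + b) / 2| < (b - a) / 4 := by
    have h := (norm_fst_le (z - (((a + b) / 2, 0), 0)).1).trans
      (norm_fst_le (z - (((a + b) / 2, 0), 0)))
    simpa [Real.norm_eq_abs] using h.trans_lt hz
  have h2 : |z.2| < (b - a) / 4 := by
    simpa [Real.norm_eq_abs] using (norm_snd_le (z - (((a + b) / 2, 0), 0))).trans_lt hz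
  rw [abs_lt] at h1 h2
  exact ⟨⟨by linarith, by linarith⟩, ⟨by linarith, by linarith⟩⟩

/-! ### Joint smoothness of the two-parameter flow -/

/-- **The two-parameter flow is jointly smooth.** If `x_{s,y}` (`s ∈ [a, b]`, `y ∈ E`) solve
`x' = u(t, x)` on `[a, b]` with `x_{s,y}(s) = y`, for a field `u` jointly smooth on the slab
`[a, b] × E` (`a < b`), then `((s, y), t) ↦ (s + t, x_{s,y}(s + t))` is `C^∞` on the domain
`{s, s + t ∈ [a, b]}`: it is a flow, within the convex set `[a, b] × E`, of the autonomised field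
`(r, x) ↦ (1, u r x)`, smooth there, so the tree's `IsFlowWithin.contDiffOn` applies (Lang 1995,
Ch. IV §1, Thm. 1.16 with p. 61; Hartman 1964, Ch. V, Cor. 3.1). [folklore] -/
theorem tautLoopFlowE_contDiffOn_flow [CompleteSpace E] {u : ℝ → E → E} {a b : ℝ} (hab : a < b)
    (hu : IsSmoothSpaceTimeOn (Icc a b) u) {α : ℝ → E → ℝ → E}
    (hα0 : ∀ s ∈ Icc a b, ∀ y, α s y s = y)
    (hα : ∀ s ∈ Icc a b, ∀ y, ∀ t ∈ Icc a b,
      HasDerivWithinAt (α s y) (u t (α s y t)) (Icc a b) t) :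
    ContDiffOn ℝ ∞ (fun z : (ℝ × E) × ℝ => ((z.1.1 + z.2, α z.1.1 z.1.2 (z.1.1 + z.2)) : ℝ × E))
      {z : (ℝ × E) × ℝ | z.1.1 ∈ Icc a b ∧ z.1.1 + z.2 ∈ Icc a b} := by
  have hflow : Literature.Analysis.ODE.IsFlowWithin (fun q : ℝ × E => (((1 : ℝ), u q.1 q.2) : ℝ × E))
      (Icc a b ×ˢ univ) (fun p t => ((p.1 + t, α p.1 p.2 (p.1 + t)) : ℝ × E))
      {z : (ℝ × E) × ℝ | z.1.1 ∈ Icc a b ∧ z.1.1 + z.2 ∈ Icc a b} := by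
    refine ⟨fun z hz => ?_, fun z hz t ht => ?_, fun z hz t ht =>
      mk_mem_prod (tautLoopFlowE_add_mem_Icc hz.1 hz.2 ht) (mem_univ _)⟩
    · simp [hα0 z.1.1 hz.1 z.1.2]
    · have hmem : z.1.1 + t ∈ Icc a b := tautLoopFlowE_add_mem_Icc hz.1 hz.2 ht
      have h1 : HasDerivWithinAt (fun r : ℝ => z.1.1 + r) 1 (uIcc 0 z.2) t := by
        simpa using (hasDerivWithinAt_id (x := t) (s := uIcc 0 z.2)).const_add z.1.1
      have h2 : HasDerivWithinAt (fun r : ℝ => α z.1.1 z.1.2 (z.1.1 + r))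
          (u (z.1.1 + t) (α z.1.1 z.1.2 (z.1.1 + t))) (uIcc 0 z.2) t := by
        have h := (hα z.1.1 hz.1 z.1.2 (z.1.1 + t) hmem).scomp t h1
          (fun r hr => tautLoopFlowE_add_mem_Icc hz.1 hz.2 hr)
        simpa [Function.comp_def] using h
      exact h1.prodMk h2
  have hG : ContDiffOn ℝ ∞ (fun q : ℝ × E => (((1 : ℝ), u q.1 q.2) : ℝ × E)) (Icc a b ×ˢ univ) :=
    contDiffOn_const.prodMk hu
  exact hflow.contDiffOn ((convex_Icc a b).prod convex_univ)
    ((uniqueDiffOn_Icc hab).prod uniqueDiffOn_univ) (tautLoopFlowE_uniqueDiffOn_dom hab)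
    (by simp) hG

/-- **The trajectory map anchored at `s₁` is jointly smooth on the slab**: with `x_{s,y}` as in
`tautLoopFlowE_contDiffOn_flow` and `s₁ ∈ [a, b]`, the map `(r, y) ↦ x_{s₁,y}(r)` is `C^∞` on
`[a, b] × E` (compose the smooth two-parameter flow with `(r, y) ↦ ((s₁, y), r - s₁)`). [folklore] -/
theorem tautLoopFlowE_isSmoothSpaceTimeOn [CompleteSpace E] {u : ℝ → E → E} {a b : ℝ}
    (hab : a < b) (hu : IsSmoothSpaceTimeOn (Icc a b) u) {α : ℝ → E → ℝ → E}
    (hα0 : ∀ s ∈ Icc a b, ∀ y, α s y s = y)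
    (hα : ∀ s ∈ Icc a b, ∀ y, ∀ t ∈ Icc a b,
      HasDerivWithinAt (α s y) (u t (α s y t)) (Icc a b) t)
    {s₁ : ℝ} (hs₁ : s₁ ∈ Icc a b) :
    IsSmoothSpaceTimeOn (Icc a b) (fun r y => α s₁ y r) := by
  have hΨ := tautLoopFlowE_contDiffOn_flow hab hu hα0 hα
  have hι : ContDiffOn ℝ ∞ (fun p : ℝ × E => ((((s₁, p.2) : ℝ × E), p.1 - s₁) : (ℝ × E) × ℝ))
      (Icc a b ×ˢ univ) :=
    (contDiffOn_const.prodMk contDiffOn_snd).prodMk (contDiffOn_fst.sub contDiffOn_const)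
  have hmaps : MapsTo (fun p : ℝ × E => ((((s₁, p.2) : ℝ × E), p.1 - s₁) : (ℝ × E) × ℝ))
      (Icc a b ×ˢ univ) {z : (ℝ × E) × ℝ | z.1.1 ∈ Icc a b ∧ z.1.1 + z.2 ∈ Icc a b} := by
    intro p hp
    refine ⟨hs₁, ?_⟩
    simpa using (mem_prod.1 hp).1
  have h := (hΨ.comp hι hmaps).snd
  change ContDiffOn ℝ ∞ (uncurry fun r y => α s₁ y r) (Icc a b ×ˢ univ)
  refine h.congr fun p _ => ?_
  obtain ⟨r, y⟩ := p
  simp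

/-! ### The registered tools stub -/

/-- **Tools stub `stub_tautLoopStepFlowExistsTools`** (serving stubs 6A/6B of line
`Sketch-ideas-r1k1`): for a field `u` jointly smooth on the slab `[a, b] × ℝ³` (`a < b`) with
`‖u‖ ≤ B₀` and `‖Du‖ ≤ B₁` there, and any anchor time `s₁ ∈ [a, b]`, there is a particle-trajectory
map `X`, jointly smooth on the slab, with `∂ᵣ X(r, y) = u(r, X(r, y))` within `[a, b]` and
`X(s₁, ·) = id` (global Picard–Lindelöf plus smooth dependence on the initial point through the
autonomised field `(1, u)` within the convex slab; Hartman 1964, Ch. V, Cor. 3.1; Lang 1995,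
Ch. IV §1, Thm. 1.16). [folklore] -/
theorem stub_tautLoopStepFlowExistsTools : ∀ (u : ℝ → EuclideanSpace ℝ (Fin 3) →
    EuclideanSpace ℝ (Fin 3)) (a b B₀ B₁ : ℝ), a < b → 0 ≤ B₀ → 0 ≤ B₁ →
    Literature.Analysis.FluidPDE.IsSmoothSpaceTimeOn (Set.Icc a b) u →
    (∀ s ∈ Set.Icc a b, ∀ x, ‖u s x‖ ≤ B₀) → (∀ s ∈ Set.Icc a b, ∀ x, ‖fderiv ℝ (u s) x‖ ≤ B₁) →
    ∀ s₁ ∈ Set.Icc a b, ∃ X : ℝ → EuclideanSpace ℝ (Fin 3) → EuclideanSpace ℝ (Fin 3),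
    Literature.Analysis.FluidPDE.IsSmoothSpaceTimeOn (Set.Icc a b) X ∧
    (∀ s ∈ Set.Icc a b, ∀ y, HasDerivWithinAt (fun r => X r y) (u s (X s y)) (Set.Icc a b) s) ∧
    (∀ y, X s₁ y = y) := by
  intro u a b B₀ B₁ hab hB₀ hB₁ hu h₀ h₁ s₁ hs₁
  have hex : ∀ s ∈ Icc a b, ∀ y : EuclideanSpace ℝ (Fin 3), ∃ α : ℝ → EuclideanSpace ℝ (Fin 3),
      α s = y ∧ ∀ t ∈ Icc a b, HasDerivWithinAt α (u t (α t)) (Icc a b) t := fun s hs y =>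
    tautLoopFlowE_exists_solution hab.le hB₀ hB₁ hu h₀ h₁ hs y
  choose! α hα0 hα using hex
  exact ⟨fun r y => α s₁ y r, tautLoopFlowE_isSmoothSpaceTimeOn hab hu hα0 hα hs₁,
    fun s hs y => hα s₁ hs₁ y s hs, fun y => hα0 s₁ hs₁ y⟩

end Summit.NavierStokesRegularity.NavierStokesRegularity.Theorems

end
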